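import Summits.CriticalPhenomena.SAWScalingLimit.Theorems.SAWDefectDecoherenceBoundaryClosureRGateStabilityReflection
import Literature.Analysis.Complex.KoebeDistortion
import Mathlib.Analysis.Complex.RemovableSingularity
import HarnessLib

/-!
# `BoundaryClosureR` (stmt-CriticalPhenomena-14004), line `polygon-parity-squeeze`, stub
# `stub_gateStability` (GS), part III: reflection at the ROOT pin and divergence of kernel limits

The second pin of the gate-stability theorem.  For a Dobrushin domain `D` flat at the ROOT
`a = D.pt 0` inside `B(a, R₀)` (with `D.pt 1 ∉ B(a, R₀)`) and a frame map `Φ : Ω → ℍₒ`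
(`‖Φ‖ → ∞` at `a`, `Φ → 0` at `D.pt 1`):

* `exists_rootReflection` — `1/Φ` extends, by Schwarz reflection across the flat piece and the
  removable singularity at `a` (`‖Φ‖ → ∞` there), to a function `h` HOLOMORPHIC AND INJECTIVE on the
  full disc `B(a, R₀)` with `h(a) = 0` and `h · Φ = 1` on the upper half-disc;
* `tendsto_norm_atTop_of_univalent_reciprocal` — **divergence of kernel limits at the root**: if
  univalent `h_i` on `B(a, R₀)` with `h_i(a) = 0` are reciprocals of maps `H_i` on the upper
  half-disc, and `H_i → G` locally uniformly there with `G` continuous and zero-free, then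
  `‖G‖ → ∞` at `a` (Cauchy's estimate bounds `h_i'` at an interior point, Koebe's distortion
  theorem transfers the bound to `h_i'(a)`, and Koebe's growth theorem then bounds `h_i`, i.e.
  `1/H_i`, uniformly by `C |z − a|` near `a`).

References: Pommerenke, *Boundary Behaviour of Conformal Maps* (1992), Thm. 1.3, Thm. 2.6;
Conway, *Functions of One Complex Variable I* (1978), IX.1.1. -/

noncomputable section

open scoped Topology ComplexConjugate
open Filter Set Metric Complex Bornology
open UpperHalfPlane (upperHalfPlaneSet)
open Literature.Probability.RandomPlanarGeometry
open Summit.CriticalPhenomena.SAWScalingLimit.Theorems.PickHalfPlane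

namespace Summit.CriticalPhenomena.SAWScalingLimit.Theorems.PolygonParitySqueeze.GateStability

/-! ### 1. Reflection of `1/Φ` across the flat root piece -/

/-- **Reflection of the reciprocal frame at the root.** Let `D` be a Dobrushin domain whose carrier
`Ω` is the open upper half-disc above the root `a = D.pt 0` inside `B(a, R₀)`, with
`D.pt 1 ∉ B(a, R₀)`, and `Φ : Ω → ℍₒ` a conformal equivalence with `‖Φ‖ → ∞` at `a` and boundary
value `0` at `D.pt 1`.  Then there is `h : ℂ → ℂ`, holomorphic and injective on `B(a, R₀)`, with
`h a = 0` and `h z · Φ z = 1` on `Ω ∩ B(a, R₀)`.  (Schwarz reflection of the injective Carathéodory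
extension across the punctured diameter, where it is real and non-zero — only `D.pt 1` is sent to
`0` —; `1/Φ → 0` at `a`, a removable singularity.) [cite: PommerenkeBBCM1992, Thm. 2.6] -/
theorem exists_rootReflection (D : DobrushinDomain) {R₀ : ℝ} (hR₀ : 0 < R₀)
    (hflat : D.carrier ∩ ball (D.pt 0) R₀ = {z : ℂ | (D.pt 0).im < z.im} ∩ ball (D.pt 0) R₀)
    (h1 : D.pt 1 ∉ ball (D.pt 0) R₀)
    (Φ : ConformalEquiv D.carrier upperHalfPlaneSet)
    (hΦ0 : Tendsto (fun z => ‖Φ z‖) (𝓝[D.carrier] (D.pt 0)) atTop)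
    (hΦ1 : Φ.HasBoundaryValue (D.pt 1) 0) :
    ∃ h : ℂ → ℂ, DifferentiableOn ℂ h (ball (D.pt 0) R₀) ∧ InjOn h (ball (D.pt 0) R₀) ∧
      h (D.pt 0) = 0 ∧ ∀ z ∈ D.carrier ∩ ball (D.pt 0) R₀, h z * Φ z = 1 := by
  obtain ⟨Φs, hΦsc, hΦse, hΦsr, hΦsi⟩ := exists_frameExtension_injOn D Φ hΦ0
  set a : ℂ := D.pt 0 with hadef
  set b : ℂ := D.pt 1 with hbdef
  have hU : IsOpen D.carrier := D.isOpen
  have hb0 : b ≠ a := fun h => absurd (D.pt_injective h) (by decide)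
  have hbcl : b ∈ closure D.carrier := frontier_subset_closure (D.pt_mem_frontier 1)
  have hacar : a ∉ D.carrier := fun h => by
    have := D.pt_mem_frontier 0; rw [frontier, hU.interior_eq] at this; exact this.2 h
  have hcar : ∀ z ∈ ball a R₀, (z ∈ D.carrier ↔ a.im < z.im) := fun z hz => mem_iff_of_flat hflat hz
  have hclos : ∀ z ∈ ball a R₀, z ≠ a → a.im ≤ z.im → z ∈ closure D.carrier \ {a} := by
    intro z hz hza hzim
    refine ⟨?_, fun h => hza (mem_singleton_iff.1 h)⟩
    rcases hzim.lt_or_eq with hlt | heq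
    · exact subset_closure ((hcar z hz).2 hlt)
    · exact Identification.mem_closure_of_flat hflat hz heq.symm
  have hfront : ∀ z ∈ ball a R₀, z.im = a.im → z ∈ frontier D.carrier := fun z hz hzim =>
    mem_frontier_of_flat hU hflat hz hzim
  -- `Φs b = 0`
  have hΦsb : Φs b = 0 := by
    haveI : NeBot (𝓝[D.carrier] b) := mem_closure_iff_nhdsWithin_neBot.1 hbcl
    have hsub : D.carrier ⊆ closure D.carrier \ {a} := fun z hz =>
      ⟨subset_closure hz, fun h => hacar (mem_singleton_iff.1 h ▸ hz)⟩
    have h1 : Tendsto Φs (𝓝[D.carrier] b) (𝓝 (Φs b)) :=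
      ((hΦsc b ⟨hbcl, fun h => hb0 (mem_singleton_iff.1 h)⟩).mono hsub).tendsto
    exact tendsto_nhds_unique (h1.congr' (eventually_mem_nhdsWithin.mono fun z hz => hΦse hz)) hΦ1
  -- the punctured disc at the origin and the translated extension
  set U : Set ℂ := ball (0 : ℂ) R₀ \ {0} with hUdef
  have hUo : IsOpen U := isOpen_ball.sdiff isClosed_singleton
  have hball : ∀ w : ℂ, w ∈ ball (0 : ℂ) R₀ ↔ w + a ∈ ball a R₀ := fun w => by
    rw [mem_ball_zero_iff, mem_ball, dist_eq_norm, add_sub_cancel_right]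
  have hUmem : ∀ w : ℂ, w ∈ U ↔ w + a ∈ ball a R₀ ∧ w + a ≠ a := fun w => by
    rw [hUdef, Set.mem_sdiff, mem_singleton_iff, hball, add_ne_right]
  have hmemU : ∀ w ∈ ball (0 : ℂ) R₀, 0 < w.im → w + a ∈ D.carrier := fun w hw hwim =>
    (hcar (w + a) ((hball w).1 hw)).2 (by simpa using hwim)
  have hsymm : ∀ w ∈ U, conj w ∈ U := fun w hw => by
    refine ⟨by rw [mem_ball_zero_iff, norm_conj, ← mem_ball_zero_iff]; exact hw.1, fun h => hw.2 ?_⟩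
    have := congrArg conj (mem_singleton_iff.1 h)
    simpa using this
  set f₀ : ℂ → ℂ := fun w => Φs (w + a) with hf₀
  have hc : ContinuousOn f₀ (U ∩ {w | 0 ≤ w.im}) := by
    refine hΦsc.comp (continuous_id.add continuous_const).continuousOn ?_
    rintro w ⟨hw, hwim⟩
    exact hclos (w + a) ((hUmem w).1 hw).1 ((hUmem w).1 hw).2 (by simpa using hwim)
  have hd : DifferentiableOn ℂ f₀ (U ∩ {w | 0 < w.im}) := by
    rintro w ⟨hw, hwim⟩
    have hwy : w + a ∈ D.carrier := hmemU w hw.1 hwim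
    have h1 : DifferentiableAt ℂ Φs (w + a) :=
      ((Φ.differentiableOn _ hwy).differentiableAt (hU.mem_nhds hwy)).congr_of_eventuallyEq
        (Filter.eventuallyEq_of_mem (hU.mem_nhds hwy) hΦse)
    exact (h1.comp w (differentiableAt_id.add_const a)).differentiableWithinAt
  have hreal : ∀ w ∈ U, w.im = 0 → conj (f₀ w) = f₀ w := fun w hw hwim =>
    conj_eq_iff_im.2 (hΦsr (w + a) (hfront (w + a) ((hUmem w).1 hw).1 (by simp [hwim])))
  set R : ℂ → ℂ := schwarzReflection f₀ with hRdef
  have hR : DifferentiableOn ℂ R U := differentiableOn_schwarzReflection hUo hsymm hc hd hreal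
  have hRup : ∀ w ∈ U, 0 < w.im → R w = Φ (w + a) := fun w hw hwim => by
    rw [hRdef, schwarzReflection_of_nonneg hwim.le]; exact hΦse (hmemU w hw.1 hwim)
  have hRupper : ∀ w ∈ U, 0 ≤ w.im → R w = Φs (w + a) := fun w _ hwim => by
    rw [hRdef, schwarzReflection_of_nonneg hwim]
  have hRlower : ∀ w ∈ U, w.im < 0 → R w = conj (Φs (conj w + a)) := fun w _ hwim => by
    rw [hRdef, schwarzReflection_of_neg hwim]
  have hreflmem : ∀ w ∈ U, w.im < 0 → conj w + a ∈ D.carrier := fun w hw hwim =>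
    hmemU _ (hsymm w hw).1 (by simp; linarith)
  have hRim_nonneg : ∀ w ∈ U, 0 ≤ w.im → 0 ≤ (R w).im := by
    intro w hw hwim
    rcases hwim.lt_or_eq with hlt | heq
    · rw [hRup w hw hlt]; exact le_of_lt (Φ.mapsTo (hmemU w hw.1 hlt))
    · rw [hRupper w hw hwim]
      exact (hΦsr (w + a) (hfront (w + a) ((hUmem w).1 hw).1 (by simp [heq.symm]))).symm.le
  have hRim_neg : ∀ w ∈ U, w.im < 0 → (R w).im < 0 := by
    intro w hw hwim
    rw [hRlower w hw hwim, conj_im, neg_lt_zero, hΦse (hreflmem w hw hwim)]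
    exact Φ.mapsTo (hreflmem w hw hwim)
  -- `R` is injective and zero-free on the punctured disc
  have hRinj : InjOn R U := by
    intro w₁ hw₁ w₂ hw₂ heq
    by_cases h₁ : 0 ≤ w₁.im <;> by_cases h₂ : 0 ≤ w₂.im
    · rw [hRupper w₁ hw₁ h₁, hRupper w₂ hw₂ h₂] at heq
      have := hΦsi (hclos _ ((hUmem w₁).1 hw₁).1 ((hUmem w₁).1 hw₁).2 (by simpa using h₁))
        (hclos _ ((hUmem w₂).1 hw₂).1 ((hUmem w₂).1 hw₂).2 (by simpa using h₂)) heq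
      exact add_right_cancel this
    · have := hRim_nonneg w₁ hw₁ h₁; rw [heq] at this
      exact absurd (hRim_neg w₂ hw₂ (not_le.1 h₂)) (not_lt.2 this)
    · have := hRim_nonneg w₂ hw₂ h₂; rw [← heq] at this
      exact absurd (hRim_neg w₁ hw₁ (not_le.1 h₁)) (not_lt.2 this)
    · rw [hRlower w₁ hw₁ (not_le.1 h₁), hRlower w₂ hw₂ (not_le.1 h₂)] at heq
      have hm₁ := hreflmem w₁ hw₁ (not_le.1 h₁)
      have hm₂ := hreflmem w₂ hw₂ (not_le.1 h₂)
      have h3 := hΦsi ⟨subset_closure hm₁, fun h => hacar (mem_singleton_iff.1 h ▸ hm₁)⟩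
        ⟨subset_closure hm₂, fun h => hacar (mem_singleton_iff.1 h ▸ hm₂)⟩
        ((starRingEnd ℂ).injective heq)
      exact (starRingEnd ℂ).injective (add_right_cancel h3)
  have hRne : ∀ w ∈ U, R w ≠ 0 := by
    intro w hw h0
    by_cases hwim : 0 ≤ w.im
    · rcases hwim.lt_or_eq with hlt | heq
      · have : (0 : ℝ) < (R w).im := by rw [hRup w hw hlt]; exact Φ.mapsTo (hmemU w hw.1 hlt)
        rw [h0, zero_im] at this
        exact lt_irrefl _ this
      · rw [hRupper w hw hwim] at h0
        have hwa := hclos _ ((hUmem w).1 hw).1 ((hUmem w).1 hw).2 (by simpa using hwim)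
        have hb' : b ∈ closure D.carrier \ {a} := ⟨hbcl, fun h => hb0 (mem_singleton_iff.1 h)⟩
        have := hΦsi hwa hb' (h0.trans hΦsb.symm)
        exact h1 (this ▸ ((hUmem w).1 hw).1)
    · have := hRim_neg w hw (not_le.1 hwim); rw [h0, zero_im] at this; exact lt_irrefl _ this
  -- `‖R‖ → ∞` at the origin within the punctured disc
  have hRinf : Tendsto (fun w => ‖R w‖) (𝓝[U] 0) atTop := by
    rw [Filter.tendsto_atTop]
    intro M
    obtain ⟨δ, hδ, hδM⟩ : ∃ δ > 0, ∀ z ∈ D.carrier, dist z a < δ → M + 1 ≤ ‖Φ z‖ := by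
      have hev := Filter.tendsto_atTop.1 hΦ0 (M + 1)
      obtain ⟨δ, hδ, hsub⟩ := Metric.eventually_nhds_iff.1 (eventually_nhdsWithin_iff.1 hev)
      exact ⟨δ, hδ, fun z hz hzd => hsub hzd hz⟩
    have hsmall : ∀ᶠ w in 𝓝[U] (0 : ℂ), ‖w‖ < δ / 2 := by
      have : ball (0 : ℂ) (δ / 2) ∈ 𝓝 (0 : ℂ) := ball_mem_nhds 0 (by positivity)
      filter_upwards [mem_nhdsWithin_of_mem_nhds this] with w hw
      exact mem_ball_zero_iff.1 hw
    filter_upwards [hsmall, self_mem_nhdsWithin] with w hwδ hw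
    have hdist : ∀ v : ℂ, ‖v‖ = ‖w‖ → dist (v + a) a < δ := fun v hv => by
      rw [dist_eq_norm, add_sub_cancel_right, hv]; linarith
    by_cases hwim : 0 ≤ w.im
    · rcases hwim.lt_or_eq with hlt | heq
      · rw [hRup w hw hlt]
        linarith [hδM (w + a) (hmemU w hw.1 hlt) (hdist w rfl)]
      · -- a real point: `Φs (w + a)` is a limit of values of norm `≥ M + 1`
        rw [hRupper w hw hwim]
        have hwa := hclos _ ((hUmem w).1 hw).1 ((hUmem w).1 hw).2 (by simpa using hwim)
        haveI : NeBot (𝓝[D.carrier] (w + a)) := mem_closure_iff_nhdsWithin_neBot.1 hwa.1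
        have hsub : D.carrier ⊆ closure D.carrier \ {a} := fun z hz =>
          ⟨subset_closure hz, fun h => hacar (mem_singleton_iff.1 h ▸ hz)⟩
        have ht : Tendsto (fun z => ‖Φ z‖) (𝓝[D.carrier] (w + a)) (𝓝 ‖Φs (w + a)‖) :=
          (((hΦsc _ hwa).mono hsub).tendsto.congr'
            (eventually_mem_nhdsWithin.mono fun z hz => hΦse hz)).norm
        have hev : ∀ᶠ z in 𝓝[D.carrier] (w + a), M + 1 ≤ ‖Φ z‖ := by
          have : ball (w + a) (δ / 2) ∈ 𝓝 (w + a) := ball_mem_nhds _ (by positivity)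
          filter_upwards [mem_nhdsWithin_of_mem_nhds this, self_mem_nhdsWithin] with z hz hzc
          refine hδM z hzc ?_
          calc dist z a ≤ dist z (w + a) + dist (w + a) a := dist_triangle _ _ _
            _ < δ / 2 + δ / 2 := by
                gcongr
                · exact mem_ball.1 hz
                · rw [dist_eq_norm, add_sub_cancel_right]; exact hwδ
            _ = δ := by ring
        linarith [ge_of_tendsto ht hev]
    · rw [hRlower w hw (not_le.1 hwim), norm_conj, hΦse (hreflmem w hw (not_le.1 hwim))]
      linarith [hδM _ (hreflmem w hw (not_le.1 hwim)) (hdist (conj w) (norm_conj w))]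
  -- the reciprocal, extended by `0` at the origin
  set H : ℂ → ℂ := Function.update (fun w => (R w)⁻¹) 0 0 with hHdef
  have hHU : ∀ w ∈ U, H w = (R w)⁻¹ := fun w hw =>
    Function.update_of_ne (fun h => hw.2 (mem_singleton_iff.2 h)) _ _
  have hH0 : H 0 = 0 := Function.update_self _ _ _
  have hb0s : ball (0 : ℂ) R₀ ∈ 𝓝 (0 : ℂ) := ball_mem_nhds 0 hR₀
  have hHd : DifferentiableOn ℂ H (ball (0 : ℂ) R₀) := by
    refine (Complex.differentiableOn_compl_singleton_and_continuousAt_iff hb0s).1 ⟨?_, ?_⟩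
    · exact ((hR.inv hRne).congr fun w hw => hHU w hw)
    · rw [hHdef, continuousAt_update_same]
      have h1 : Tendsto R (𝓝[U] 0) (cobounded ℂ) := tendsto_norm_atTop_iff_cobounded.1 hRinf
      have h2 : Tendsto (fun w => (R w)⁻¹) (𝓝[U] 0) (𝓝 0) := tendsto_inv₀_cobounded.comp h1
      have hUeq : 𝓝[≠] (0 : ℂ) = 𝓝[U] 0 := by
        rw [nhdsWithin_restrict' {(0 : ℂ)}ᶜ hb0s, hUdef, sdiff_eq_compl_inter]
      rw [hUeq]
      exact h2
  have hHinj : InjOn H (ball (0 : ℂ) R₀) := by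
    intro w₁ hw₁ w₂ hw₂ heq
    by_cases h₁ : w₁ = 0 <;> by_cases h₂ : w₂ = 0
    · rw [h₁, h₂]
    · exfalso
      have hU₂ : w₂ ∈ U := ⟨hw₂, fun h => h₂ (mem_singleton_iff.1 h)⟩
      rw [h₁, hH0, hHU w₂ hU₂] at heq
      exact inv_ne_zero (hRne w₂ hU₂) heq.symm
    · exfalso
      have hU₁ : w₁ ∈ U := ⟨hw₁, fun h => h₁ (mem_singleton_iff.1 h)⟩
      rw [h₂, hH0, hHU w₁ hU₁] at heq
      exact inv_ne_zero (hRne w₁ hU₁) heq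
    · have hU₁ : w₁ ∈ U := ⟨hw₁, fun h => h₁ (mem_singleton_iff.1 h)⟩
      have hU₂ : w₂ ∈ U := ⟨hw₂, fun h => h₂ (mem_singleton_iff.1 h)⟩
      rw [hHU w₁ hU₁, hHU w₂ hU₂, inv_inj] at heq
      exact hRinj hU₁ hU₂ heq
  -- translate back to the root
  have hmaps : MapsTo (fun z : ℂ => z - a) (ball a R₀) (ball (0 : ℂ) R₀) := fun z hz => by
    rw [hball, sub_add_cancel]; exact hz
  refine ⟨fun z => H (z - a), hHd.comp (differentiableOn_id.sub_const a) hmaps,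
    fun z₁ hz₁ z₂ hz₂ heq => sub_left_injective (hHinj (hmaps hz₁) (hmaps hz₂) heq),
    by simp only [sub_self]; exact hH0, ?_⟩
  rintro z ⟨hzc, hzb⟩
  have hza : z ≠ a := fun h => hacar (h ▸ hzc)
  have hzU : z - a ∈ U := (hUmem (z - a)).2 ⟨by simpa using hzb, by simpa using hza⟩
  have hzim : 0 < (z - a).im := by simpa [sub_im, sub_pos] using (hcar z hzb).1 hzc
  have hΦz : R (z - a) = Φ z := by rw [hRup _ hzU hzim, sub_add_cancel]
  have hne : (Φ : ℂ → ℂ) z ≠ 0 := fun h => by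
    have : (0 : ℝ) < ((Φ : ℂ → ℂ) z).im := Φ.mapsTo hzc
    rw [h, zero_im] at this
    exact lt_irrefl _ this
  show H (z - a) * Φ z = 1
  rw [hHU _ hzU, hΦz, inv_mul_cancel₀ hne]
/-! ### 2. Divergence of kernel limits at the root -/

/-- **Kernel limits diverge at a pinned root.** Let `h_i` be holomorphic and injective on
`B(a, R₀)` with `h_i(a) = 0`, and `h_i · H_i = 1` on the upper half-disc
`B⁺ = {im > im a} ∩ B(a, R₀)`.  If `H_i → G` locally uniformly on `B⁺` with `G` continuous and
zero-free there, then `‖G‖ → ∞` at `a` within `B⁺`.  (On a closed disc `K ⊂ B⁺` around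
`z₂ = a + i R₀/2` the `H_i` are eventually bounded below by `μ/2`, `μ = min_K ‖G‖ > 0`, so
`‖h_i‖ ≤ 2/μ` on `K`; Cauchy's estimate bounds `h_i'(z₂)`, Koebe's distortion theorem bounds
`h_i'(a)` by a constant `A`, and Koebe's growth theorem gives `‖h_i(z)‖ ≤ A R₀ t/(1−t)²`,
`t = |z − a|/R₀`; hence `‖G(z)‖ ≥ (1−t)²/(A R₀ t) → ∞`.)
[cite: PommerenkeBBCM1992, Thm. 1.3] -/
theorem tendsto_norm_atTop_of_univalent_reciprocal {a : ℂ} {R₀ : ℝ} (hR₀ : 0 < R₀)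
    {h : ℕ → ℂ → ℂ} (hd : ∀ i, DifferentiableOn ℂ (h i) (ball a R₀))
    (hinj : ∀ i, InjOn (h i) (ball a R₀)) (h0 : ∀ i, h i a = 0)
    {H : ℕ → ℂ → ℂ} (hH : ∀ i, ∀ z ∈ {z : ℂ | a.im < z.im} ∩ ball a R₀, h i z * H i z = 1)
    {G : ℂ → ℂ} (hG : ContinuousOn G ({z : ℂ | a.im < z.im} ∩ ball a R₀))
    (hG0 : ∀ z ∈ {z : ℂ | a.im < z.im} ∩ ball a R₀, G z ≠ 0)
    (hlim : TendstoLocallyUniformlyOn H G atTop ({z : ℂ | a.im < z.im} ∩ ball a R₀)) :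
    Tendsto (fun z => ‖G z‖) (𝓝[{z : ℂ | a.im < z.im} ∩ ball a R₀] a) atTop := by
  set Bp : Set ℂ := {z : ℂ | a.im < z.im} ∩ ball a R₀ with hBpdef
  have hBpo : IsOpen Bp := (isOpen_lt continuous_const continuous_im).inter isOpen_ball
  -- a closed disc `K` in the upper half-disc
  set z₂ : ℂ := a + ((R₀ / 2 : ℝ) : ℂ) * I with hz₂def
  set δ : ℝ := R₀ / 4 with hδdef
  have hδ : 0 < δ := by positivity
  have hz₂a : ‖z₂ - a‖ = R₀ / 2 := by
    rw [hz₂def, add_sub_cancel_left, norm_mul, norm_real, norm_I, mul_one, Real.norm_of_nonneg]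
    positivity
  have hz₂im : z₂.im = a.im + R₀ / 2 := by simp [hz₂def]
  have hKsub : closedBall z₂ δ ⊆ Bp := by
    intro w hw
    rw [mem_closedBall, dist_eq_norm] at hw
    refine ⟨?_, ?_⟩
    · show a.im < w.im
      have : |(w - z₂).im| ≤ ‖w - z₂‖ := abs_im_le_norm _
      rw [sub_im, abs_le] at this
      linarith [this.1]
    · rw [mem_ball, dist_eq_norm]
      calc ‖w - a‖ = ‖(w - z₂) + (z₂ - a)‖ := by ring_nf
        _ ≤ ‖w - z₂‖ + ‖z₂ - a‖ := norm_add_le _ _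
        _ < R₀ := by rw [hz₂a]; linarith
  have hz₂ball : z₂ ∈ ball a R₀ := (hKsub (mem_closedBall_self hδ.le)).2
  -- `μ = min_K ‖G‖ > 0`
  obtain ⟨w₀, hw₀, hmin⟩ := (isCompact_closedBall z₂ δ).exists_isMinOn
    ⟨z₂, mem_closedBall_self hδ.le⟩ ((hG.mono hKsub).norm)
  set μ : ℝ := ‖G w₀‖ with hμdef
  have hμ : 0 < μ := norm_pos_iff.2 (hG0 w₀ (hKsub hw₀))
  have hμle : ∀ w ∈ closedBall z₂ δ, μ ≤ ‖G w‖ := fun w hw => hmin hw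
  -- eventually `‖h_i‖ ≤ 2/μ` on `K`
  have hunifK : TendstoUniformlyOn H G atTop (closedBall z₂ δ) :=
    (tendstoLocallyUniformlyOn_iff_forall_isCompact hBpo).1 hlim _ hKsub (isCompact_closedBall _ _)
  have hev : ∀ᶠ i in atTop, ∀ w ∈ closedBall z₂ δ, ‖h i w‖ ≤ 2 / μ := by
    filter_upwards [(Metric.tendstoUniformlyOn_iff.1 hunifK) (μ / 2) (by positivity)] with i hi w hw
    have hdist := hi w hw
    rw [dist_eq_norm] at hdist
    have hHge : μ / 2 ≤ ‖H i w‖ := by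
      have := norm_sub_norm_le (G w) (H i w)
      linarith [hμle w hw]
    have hprod := hH i w (hKsub hw)
    have hnorm : ‖h i w‖ * ‖H i w‖ = 1 := by rw [← norm_mul, hprod, norm_one]
    have hHpos : 0 < ‖H i w‖ := by linarith
    rw [le_div_iff₀ hμ]
    nlinarith
  -- Cauchy + Koebe: a uniform bound `A` for `‖h_i'(a)‖`
  set A : ℝ := 27 / 4 * (2 / μ / δ) with hAdef
  have hA : 0 < A := by positivity
  have hderiv : ∀ᶠ i in atTop, ‖deriv (h i) a‖ ≤ A := by
    filter_upwards [hev] with i hi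
    have hcauchy : ‖deriv (h i) z₂‖ ≤ 2 / μ / δ :=
      Complex.norm_deriv_le_of_forall_mem_sphere_norm_le hδ
        ((hd i).diffContOnCl_ball ((hKsub.trans inter_subset_right)))
        fun w hw => hi w (sphere_subset_closedBall hw)
    have hkoebe := (Literature.Analysis.Complex.AreaThm.distortion_ball hR₀ (hd i) (hinj i) hz₂ball).2.1
    rw [hz₂a] at hkoebe
    have ht : R₀ / 2 / R₀ = 1 / 2 := by field_simp
    rw [ht] at hkoebe
    norm_num at hkoebe
    rw [hAdef]
    linarith
  -- Koebe growth: `‖h_i z‖ ≤ A R₀ t/(1-t)²`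
  have hgrowth : ∀ᶠ i in atTop, ∀ z ∈ ball a R₀,
      ‖h i z‖ ≤ A * R₀ * (‖z - a‖ / R₀ / (1 - ‖z - a‖ / R₀) ^ 2) := by
    filter_upwards [hderiv] with i hi z hz
    have hk := (Literature.Analysis.Complex.AreaThm.distortion_ball hR₀ (hd i) (hinj i) hz).2.2
    rw [h0 i, sub_zero] at hk
    have ht0 : 0 ≤ ‖z - a‖ / R₀ / (1 - ‖z - a‖ / R₀) ^ 2 := by
      have : ‖z - a‖ / R₀ < 1 := by
        rw [div_lt_one hR₀]; rwa [mem_ball, dist_eq_norm] at hz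
      positivity
    calc ‖h i z‖ ≤ ‖deriv (h i) a‖ * R₀ * (‖z - a‖ / R₀ / (1 - ‖z - a‖ / R₀) ^ 2) := hk
      _ ≤ A * R₀ * (‖z - a‖ / R₀ / (1 - ‖z - a‖ / R₀) ^ 2) := by gcongr
  -- hence `1 ≤ A R₀ t/(1-t)² ‖G z‖` on the upper half-disc
  have hlower : ∀ z ∈ Bp, 1 ≤ A * R₀ * (‖z - a‖ / R₀ / (1 - ‖z - a‖ / R₀) ^ 2) * ‖G z‖ := by
    intro z hz
    have hGz : Tendsto (fun i => A * R₀ * (‖z - a‖ / R₀ / (1 - ‖z - a‖ / R₀) ^ 2) * ‖H i z‖)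
        atTop (𝓝 (A * R₀ * (‖z - a‖ / R₀ / (1 - ‖z - a‖ / R₀) ^ 2) * ‖G z‖)) :=
      ((hlim.tendsto_at hz).norm).const_mul _
    refine ge_of_tendsto hGz ?_
    filter_upwards [hgrowth] with i hi
    have hprod := hH i z hz
    have hnorm : ‖h i z‖ * ‖H i z‖ = 1 := by rw [← norm_mul, hprod, norm_one]
    calc (1 : ℝ) = ‖h i z‖ * ‖H i z‖ := hnorm.symm
      _ ≤ A * R₀ * (‖z - a‖ / R₀ / (1 - ‖z - a‖ / R₀) ^ 2) * ‖H i z‖ := by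
          gcongr; exact hi z hz.2
  -- conclusion
  rw [Filter.tendsto_atTop]
  intro M
  set t₀ : ℝ := min (1 / 2) (1 / (4 * A * R₀ * max M 1)) with ht₀def
  have ht₀ : 0 < t₀ := by positivity
  have hmem : ball a (R₀ * t₀) ∈ 𝓝[Bp] a := mem_nhdsWithin_of_mem_nhds (ball_mem_nhds a (by positivity))
  filter_upwards [hmem, self_mem_nhdsWithin] with z hz hzBp
  set t : ℝ := ‖z - a‖ / R₀ with htdef
  have ht : t < t₀ := by
    rw [htdef, div_lt_iff₀ hR₀]; rw [mem_ball, dist_eq_norm] at hz; linarith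
  have htnn : 0 ≤ t := by positivity
  have ht12 : t ≤ 1 / 2 := ht.le.trans (min_le_left _ _)
  have hkey := hlower z hzBp
  rw [← htdef] at hkey
  -- `t/(1-t)² ≤ 4 t ≤ 4 t₀`
  have hfrac : t / (1 - t) ^ 2 ≤ 4 * t₀ := by
    have h1t : (1 : ℝ) / 4 ≤ (1 - t) ^ 2 := by nlinarith
    rw [div_le_iff₀ (by positivity)]
    calc t ≤ t₀ := ht.le
      _ = 4 * t₀ * (1 / 4) := by ring
      _ ≤ 4 * t₀ * (1 - t) ^ 2 := by gcongr
  have h1 : 1 ≤ A * R₀ * (4 * t₀) * ‖G z‖ := by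
    calc (1 : ℝ) ≤ A * R₀ * (t / (1 - t) ^ 2) * ‖G z‖ := hkey
      _ ≤ A * R₀ * (4 * t₀) * ‖G z‖ := by gcongr
  have h2 : A * R₀ * (4 * t₀) * max M 1 ≤ 1 := by
    have : t₀ ≤ 1 / (4 * A * R₀ * max M 1) := min_le_right _ _
    rw [le_div_iff₀ (by positivity)] at this
    linarith
  have h3 : max M 1 ≤ ‖G z‖ := by
    by_contra hlt
    push Not at hlt
    have : A * R₀ * (4 * t₀) * ‖G z‖ < A * R₀ * (4 * t₀) * max M 1 := by gcongr
    linarith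
  exact (le_max_left M 1).trans h3

/-! ### Registered form -/

/-- **Registered helper `gateStability_rootReflection`** (∀-closed form of `exists_rootReflection`;
sub-goal of stub `stub_gateStability`, crux stmt-CriticalPhenomena-14004, line
`polygon-parity-squeeze`): the reciprocal frame extends across the flat root piece to a univalent
function on the root disc vanishing at the root. [cite: PommerenkeBBCM1992, Thm. 2.6] -/
theorem gateStability_rootReflection : ∀ (D : DobrushinDomain) (R₀ : ℝ), 0 < R₀ → D.carrier ∩ Metric.ball (D.pt 0) R₀ = {z : ℂ | (D.pt 0).im < z.im} ∩ Metric.ball (D.pt 0) R₀ → D.pt 1 ∉ Metric.ball (D.pt 0) R₀ → ∀ (Φ : ConformalEquiv D.carrier UpperHalfPlane.upperHalfPlaneSet), Filter.Tendsto (fun z => ‖Φ z‖) (𝓝[D.carrier] (D.pt 0)) Filter.atTop → Φ.HasBoundaryValue (D.pt 1) 0 → ∃ h : ℂ → ℂ, DifferentiableOn ℂ h (Metric.ball (D.pt 0) R₀) ∧ Set.InjOn h (Metric.ball (D.pt 0) R₀) ∧ h (D.pt 0) = 0 ∧ ∀ z ∈ D.carrier ∩ Metric.ball (D.pt 0) R₀,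 h z * Φ z = 1 :=
  fun D _ hR₀ hflat h1 Φ hΦ0 hΦ1 => exists_rootReflection D hR₀ hflat h1 Φ hΦ0 hΦ1

end Summit.CriticalPhenomena.SAWScalingLimit.Theorems.PolygonParitySqueeze.GateStability

end
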